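import Summits.QuantumAdvantage.AdviceFreeQNC0.FibreDecimation37NHFibre
import HarnessLib

/-!
# Cell qa-qnc0, `p = 3` — ROUND-38P2 Lemma 38.A (ii) + Theorem 37.F′ for a SUB-ROW base row: the dense test `k₀` need only be
# `a`-COMPATIBLE on the chosen coins (zeros allowed) with at least TWO support coins

Planner qa-qnc0-p2 g38, ROUND-38P2 §1.1 / Lemma 38.A and the typed `Exp38p2.FibreNonExact38` (hypotheses `Compatible a (β_{k₀}|_M)`,
`2 ≤ #{i : β_{k₀}(ι i) ≠ 0}`); P2-38h (3)(a): "Lemma 38.A(ii) (`B_{k₀} = 0`, `A_{k₀} = U_Z(α + n') ≠ 0` for a compatible sub-row with ≥ 2 support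
coins) replacing `coefA_neg_pattern`".  This file proves exactly that and re-runs the 37.F′ assembly of `FibreDecimation37NH.lean` with it:

* `compatible_add_single_iff'`, `Lfun_chiDir_add_single_of_compatible` — for compatible `δ`: `L_a(χ_{δ+e_i}) = [a_i = 2 ↔ δ_i ≠ 0]·ω²·L_a(χ_δ)`;
* **`coefA_subrow_eq`** — `A(δ) = L_a(χ_δ)·((1 + ε + n') + mω)`, hence **`coefA_subrow_ne_zero`** (`m` odd); **`coefA_neg_subrow`** — `A(−δ) = 0`
  through a second support coin; `accSet_subrow_genuine` (the decoded test `k₀` is genuine);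
* **`fibreNonExact37NH_of_genuine`** — the 37.F′ assembly with the genuineness of `k₀` as hypothesis, and
  **`fibreNonExact37NH_subrow`** — `Exp38p2.FibreNonExact38` with (NH) in place of (NH_{s₀}): `m` odd, `|Y| ≥ 1`, `β_{k₀}|_M` compatible with
  ≥ 2 support coins, (NH) ⇒ `#{u ∈ H_ε : f ≡ λ} ≤ (1 − 2^{−(m+3)})·2^{z−1}` (no `3 ≤ m` needed: two support coins force it where it matters).

WHAT THIS IS NOT: the mixed-norm STEP 3 of Theorem 38.F (hypothesis (NH_{s₀}), Lemma 38.C) is not attempted; crux 22907 untouched; no separation.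
-/

noncomputable section

namespace Summit.QuantumAdvantage.AdviceFreeQNC0.Exp37

open Finset
open Summit.QuantumAdvantage.AdviceFreeQNC0 F4
open Literature.Computability.MetaComplexity Literature.Computability.MetaComplexity.ModTestProduct

variable {z s m : ℕ}

/-! ### Lemma 38.A (ii): the coefficients of a compatible sub-row -/

/-- For a compatible `δ`, `δ + e_i` is compatible iff (`a_i = 2` exactly when `i` is a support coin). -/
theorem compatible_add_single_iff' (a : Fin m → Bool) {δ : Fin m → ZMod 3} (hc : Compatible a δ) (i : Fin m) :
    Compatible a (δ + Pi.single i 1) ↔ (a i = true ↔ δ i ≠ 0) := by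
  classical
  have l1 : lettZ false = 1 := by decide
  have l2 : lettZ true = 2 := by decide
  constructor
  · intro h
    by_cases hδ : δ i = 0
    · -- then `(δ + e_i) i = 1` must be the letter of `a i`, i.e. `a i = false`
      have h1 := h i (by rw [Pi.add_apply, Pi.single_eq_same, hδ]; decide)
      rw [Pi.add_apply, Pi.single_eq_same, hδ, zero_add] at h1
      constructor
      · intro hai; rw [hai, l2] at h1; exact absurd h1 (by decide)
      · intro hne; exact absurd hδ hne
    · -- then `δ i = lett (a i)` and `δ i + 1` must be `0` (else it is an incompatible non-zero letter)
      have hδi := hc i hδ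
      constructor
      · intro _; exact hδ
      · intro _
        by_contra hai
        rw [Bool.not_eq_true] at hai
        rw [hai, l1] at hδi
        have h1 := h i (by rw [Pi.add_apply, Pi.single_eq_same, hδi]; decide)
        rw [Pi.add_apply, Pi.single_eq_same, hδi, hai, l1] at h1
        exact absurd h1 (by decide)
  · intro hiff j hj
    by_cases hji : j = i
    · subst hji
      rw [Pi.add_apply, Pi.single_eq_same] at hj ⊢
      by_cases hδ : δ j = 0
      · have haf : a j = false := by
          by_contra hat; rw [Bool.not_eq_false] at hat; exact (hiff.1 hat) hδ
        rw [hδ, zero_add, haf, l1]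
      · have hat : a j = true := hiff.2 hδ
        rw [hc j hδ, hat, l2] at hj
        exact absurd (by decide) hj
    · rw [Pi.add_apply, Pi.single_eq_of_ne hji, add_zero] at hj ⊢
      exact hc j hj

/-- For a compatible `δ`: `L_a(χ_{δ + e_i}) = [a_i = 2 ↔ δ_i ≠ 0]·ω²·L_a(χ_δ)`. -/
theorem Lfun_chiDir_add_single_of_compatible (a : Fin m → Bool) {δ : Fin m → ZMod 3} (hc : Compatible a δ) (i : Fin m) :
    Lfun a (chiDir (δ + Pi.single i 1)) =
      if (a i = true ↔ δ i ≠ 0) then ω ^ 2 * Lfun a (chiDir δ) else 0 := by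
  classical
  have l1 : lettZ false = 1 := by decide
  have l2 : lettZ true = 2 := by decide
  rw [lfunChiDirLaw m a (δ + Pi.single i 1), lfunChiDirLaw m a δ, if_pos hc]
  by_cases hiff : (a i = true ↔ δ i ≠ 0)
  · rw [if_pos ((compatible_add_single_iff' a hc i).2 hiff), if_pos hiff]
    by_cases hδ : δ i = 0
    · -- `a i = false`, the zero set loses `i`
      have haf : a i = false := by
        by_contra hat; rw [Bool.not_eq_false] at hat; exact (hiff.1 hat) hδ
      have hfilter : (univ.filter fun j : Fin m => ((δ + Pi.single i (1 : ZMod 3) : Fin m → ZMod 3) j = 0)) =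
          (univ.filter fun j : Fin m => δ j = 0).erase i := by
        ext j
        simp only [mem_filter, mem_univ, true_and, mem_erase]
        by_cases hji : j = i
        · subst hji; rw [Pi.add_apply, Pi.single_eq_same, hδ]; simp
        · rw [Pi.add_apply, Pi.single_eq_of_ne hji, add_zero]; simp [hji]
      have hmem : i ∈ univ.filter fun j : Fin m => δ j = 0 := mem_filter.2 ⟨mem_univ _, hδ⟩
      rw [hfilter, ← mul_prod_erase _ _ hmem, haf]
      unfold lett
      simp only [Bool.false_eq_true, if_false, pow_one]
      rw [← mul_assoc, ← pow_succ, omega_pow_mod 3]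
      simp
    · -- `a i = true`, the zero set gains `i`
      have hat : a i = true := hiff.2 hδ
      have hfilter : (univ.filter fun j : Fin m => ((δ + Pi.single i (1 : ZMod 3) : Fin m → ZMod 3) j = 0)) =
          insert i (univ.filter fun j : Fin m => δ j = 0) := by
        ext j
        simp only [mem_filter, mem_univ, true_and, mem_insert]
        by_cases hji : j = i
        · subst hji
          have h21 : (2 : ZMod 3) + 1 = 0 := by decide
          rw [Pi.add_apply, Pi.single_eq_same, hc j hδ, hat, l2]; simp [h21]
        · rw [Pi.add_apply, Pi.single_eq_of_ne hji, add_zero]; simp [hji]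
      have hnot : i ∉ univ.filter fun j : Fin m => δ j = 0 := fun h => hδ (mem_filter.1 h).2
      rw [hfilter, prod_insert hnot, hat]
      rfl
  · rw [if_neg (fun h => hiff ((compatible_add_single_iff' a hc i).1 h)), if_neg hiff]

/-- **`A(δ) = L_a(χ_δ)·((1 + ε + n') + mω)`** for a compatible sub-row, `n' = #{i : a_i = 2 ↔ δ_i ≠ 0}`. -/
theorem coefA_subrow_eq (a : Fin m → Bool) (ε : ℕ) {δ : Fin m → ZMod 3} (hc : Compatible a δ) :
    coefA a ε δ = Lfun a (chiDir δ) *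
      (((1 + ε + (univ.filter fun i : Fin m => (a i = true ↔ δ i ≠ 0)).card : ℕ) : F4) + (m : F4) * ω) := by
  classical
  rw [coefA_expand, Finset.sum_congr rfl fun i _ => Lfun_chiDir_add_single_of_compatible a hc i, Finset.sum_ite,
    Finset.sum_const_zero, add_zero, Finset.sum_const, nsmul_eq_mul]
  push_cast
  have h3 : ω * ω ^ 2 = 1 := by rw [← pow_succ', omega_pow_mod 3]; simp
  linear_combination ((univ.filter fun i : Fin m => (a i = true ↔ δ i ≠ 0)).card : F4) * Lfun a (chiDir δ) * h3

/-- **`A(δ) ≠ 0`** for a compatible sub-row (`m` odd). -/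
theorem coefA_subrow_ne_zero (a : Fin m → Bool) (ε : ℕ) {δ : Fin m → ZMod 3} (hc : Compatible a δ) (hm : Odd m) :
    coefA a ε δ ≠ 0 := by
  classical
  rw [coefA_subrow_eq a ε hc]
  have hm1 : (m : F4) = 1 := by rw [natCast_eq, if_pos (Nat.odd_iff.mp hm)]
  rw [hm1, one_mul]
  have hL : IsUnit (Lfun a (chiDir δ)) := by
    rw [lfunChiDirLaw m a δ, if_pos hc]
    exact IsUnit.prod_iff.2 fun i _ => isUnit_omega_pow _
  exact ne_zero_of_isUnit (hL.mul (isUnit_natCast_add_omega _))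

/-- **`A(−δ) = 0`** for a compatible sub-row with at least two support coins (the second support coin keeps `−δ + e_i` incompatible). -/
theorem coefA_neg_subrow (a : Fin m → Bool) (ε : ℕ) {δ : Fin m → ZMod 3} (hc : Compatible a δ)
    (h2 : 2 ≤ (univ.filter fun i : Fin m => δ i ≠ 0).card) : coefA a ε (-δ) = 0 := by
  classical
  obtain ⟨i₁, hi₁, i₂, hi₂, hne⟩ := Finset.one_lt_card.1 (show 1 < (univ.filter fun i : Fin m => δ i ≠ 0).card by omega)
  rw [mem_filter] at hi₁ hi₂
  refine coefA_eq_zero_of_incompatible ε ?_ ?_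
  · intro h
    have h1 := h i₁ (by rw [Pi.neg_apply, neg_ne_zero]; exact hi₁.2)
    rw [Pi.neg_apply, hc i₁ hi₁.2] at h1
    exact neg_lettZ_ne _ h1
  · intro i h
    -- a support coin `j ≠ i`
    obtain ⟨j, hj, hji⟩ : ∃ j, δ j ≠ 0 ∧ j ≠ i := by
      by_cases h1 : i₁ = i
      · exact ⟨i₂, hi₂.2, fun h' => hne (h1.trans h'.symm)⟩
      · exact ⟨i₁, hi₁.2, h1⟩
    have h1 := h j (by rw [Pi.add_apply, Pi.neg_apply, Pi.single_eq_of_ne hji, add_zero, neg_ne_zero]; exact hj)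
    rw [Pi.add_apply, Pi.neg_apply, Pi.single_eq_of_ne hji, add_zero, hc j hj] at h1
    exact neg_lettZ_ne _ h1

/-- **The decoded test `k₀` is genuine for a compatible sub-row with ≥ 2 support coins** (`m` odd). -/
theorem accSet_subrow_genuine (ι : Fin m ↪ Fin z) (β : Fin s → Fin z → ZMod 3) (r : Fin s → ZMod 3)
    (a : Fin m → Bool) (ε : ℕ) (hm : Odd m) (k₀ : Fin s) (hc : Compatible a (restrictM ι β k₀))
    (h2 : 2 ≤ (univ.filter fun i : Fin m => β k₀ (ι i) ≠ 0).card) :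
    (accSet ι β r a ε k₀).Nonempty ∧ accSet ι β r a ε k₀ ≠ univ := by
  have hB : coefA a ε (-restrictM ι β k₀) = 0 := coefA_neg_subrow a ε hc h2
  obtain ⟨t, t', htt⟩ := psi_nonconst (isUnit_theta a ε hm) (coefA_subrow_ne_zero a ε hc hm)
  rw [← hB] at htt
  have hmem : ∀ τ : ZMod 3, τ + r k₀ ∈ accSet ι β r a ε k₀ ↔
      psi (theta a ε) (coefA a ε (restrictM ι β k₀)) (coefA a ε (-restrictM ι β k₀)) τ = 1 := by
    intro τ
    unfold accSet
    rw [mem_filter, add_sub_cancel_right]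
    simp
  rcases psi_cases (theta a ε) (coefA a ε (restrictM ι β k₀)) (coefA a ε (-restrictM ι β k₀)) t with ht | ht <;>
    rcases psi_cases (theta a ε) (coefA a ε (restrictM ι β k₀)) (coefA a ε (-restrictM ι β k₀)) t' with ht' | ht'
  · exact absurd (ht.trans ht'.symm) htt
  · refine ⟨⟨t' + r k₀, (hmem t').2 ht'⟩, fun hu => ?_⟩
    have h := (hmem t).1 (by rw [hu]; exact mem_univ _)
    rw [ht] at h; exact one_ne_zero' h.symm
  · refine ⟨⟨t + r k₀, (hmem t).2 ht⟩, fun hu => ?_⟩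
    have h := (hmem t').1 (by rw [hu]; exact mem_univ _)
    rw [ht'] at h; exact one_ne_zero' h.symm
  · exact absurd (ht.trans ht'.symm) htt

/-! ### The assembly with genuineness as hypothesis -/

/-- **37.F′ assembly from a genuine decoded test `k₀`** (`m` odd, `|Y| ≥ 1`, (NH)). -/
theorem fibreNonExact37NH_of_genuine (z s m : ℕ) (ι : Fin m ↪ Fin z) (β : Fin s → Fin z → ZMod 3)
    (r : Fin s → ZMod 3) (k₀ : Fin s) (a : Fin m → Bool) (hm : Odd m) (hz : 1 ≤ z - m) (hNH : NHCond ι a β) (ε μ₀ : ℕ)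
    (S : Finset (Fin z)) (hk : (accSet ι β r a ε k₀).Nonempty ∧ accSet ι β r a ε k₀ ≠ univ) :
    (((coset z ε).filter fun u => testParity β r u % 2 = affTarget μ₀ S u % 2).card : ℝ)
      ≤ (1 - (2 : ℝ)⁻¹ ^ (m + 3)) * (2 : ℝ) ^ (z - 1) := by
  classical
  set agree : (Fin z → Bool) → Prop := fun u => testParity β r u % 2 = affTarget μ₀ S u % 2 with hagree
  have hHcard : ((coset z ε).card : ℝ) = (2 : ℝ) ^ (z - 1) := by
    have h := card_parityClass (ι := Fin z) (by rw [Fintype.card_fin]; omega) ε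
    rw [Fintype.card_fin] at h
    exact h
  have hsplitH := card_filter_add_card_filter_not (s := coset z ε) agree
  set D : Finset (Fin z → Bool) := (coset z ε).filter fun u => ¬ agree u with hD
  have hn : Fintype.card (Out ι) = z - m := card_out ι
  have hnpos : 0 < Fintype.card (Out ι) := by rw [hn]; exact hz
  set Yev : Finset (Out ι → Bool) := univ.filter fun y => (univ.filter fun c => y c = true).card % 2 = 0 % 2 with hYev
  have hYcard : (Yev.card : ℝ) = (2 : ℝ) ^ (z - m - 1) := by
    rw [← hn]; exact card_parityClass hnpos 0
  set res : (Fin z → Bool) → (Out ι → Bool) := fun u c => u c.1 with hres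
  set Bset : Finset (Out ι → Bool) := Yev.filter fun y => ∃ u ∈ D, res u = y with hBset
  set Good : Finset (Out ι → Bool) := Yev.filter fun y => ¬ ∃ u ∈ D, res u = y with hGood
  have hsplitY := card_filter_add_card_filter_not (s := Yev) (fun y => ∃ u ∈ D, res u = y)
  have hBD : Bset.card ≤ D.card := by
    refine Finset.card_le_card_of_injOn
      (fun y => if h : ∃ u ∈ D, res u = y then h.choose else fun _ => false) (fun y hy => ?_) ?_
    · obtain ⟨-, h⟩ := mem_filter.1 hy
      simp only [dif_pos h]
      exact h.choose_spec.1
    · intro y hy y' hy' heq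
      obtain ⟨-, h⟩ := mem_filter.1 (mem_coe.1 hy)
      obtain ⟨-, h'⟩ := mem_filter.1 (mem_coe.1 hy')
      simp only [dif_pos h, dif_pos h'] at heq
      calc y = res h.choose := h.choose_spec.2.symm
        _ = res h'.choose := by rw [heq]
        _ = y' := h'.choose_spec.2
  have hGoodP : Good ⊆ univ.filter fun y : Out ι → Bool =>
      (univ.filter fun c => y c = true).card % 2 = 0 % 2 ∧
        (univ.filter fun k => subsetSum (dirOut ι β k) y ∈ accSet ι β r a ε k).card % 2 = cStar ι a ε S % 2 := by
    intro y hy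
    obtain ⟨hyev, hgood⟩ := mem_filter.1 hy
    obtain ⟨-, hy0⟩ := mem_filter.1 hyev
    refine mem_filter.2 ⟨mem_univ _, hy0, ?_⟩
    refine good_fibre_parity ι β r a μ₀ ε S hm y (by omega) fun u hu hres' => ?_
    by_contra hne
    exact hgood ⟨u, mem_filter.2 ⟨hu, hne⟩, hres'⟩
  obtain ⟨hk₀, hk₀'⟩ := hk
  have hP := card_parityClass_filter_le (dirOut ι β) (accSet ι β r a ε) (decimSet ι a β)
    (accSet_eq_empty_of_not_mem_decimSet ι β r a ε hm) k₀ hk₀ hk₀' hnpos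
    (nh_weight_sum_le ι a β hNH _ fun j => by simp only [mem_filter, mem_univ, true_and]) 0 (cStar ι a ε S)
  rw [hn] at hP
  have hGoodNat : Good.card ≤ _ := card_le_card hGoodP
  have hGood : (Good.card : ℝ) ≤ 7 / 8 * (2 : ℝ) ^ (z - m - 1) := (Nat.cast_le.2 hGoodNat).trans hP
  have hsplitHR : (((coset z ε).filter agree).card : ℝ) + (D.card : ℝ) = (2 : ℝ) ^ (z - 1) := by
    rw [← hHcard]; exact_mod_cast hsplitH
  have hsplitYR : (Bset.card : ℝ) + (Good.card : ℝ) = (2 : ℝ) ^ (z - m - 1) := by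
    rw [← hYcard]; exact_mod_cast hsplitY
  have hBDR : (Bset.card : ℝ) ≤ (D.card : ℝ) := by exact_mod_cast hBD
  have hpow : (2 : ℝ) ^ (z - 1) = (2 : ℝ) ^ m * (2 : ℝ) ^ (z - m - 1) := by
    rw [← pow_add]; congr 1; omega
  have hinv : (2 : ℝ)⁻¹ ^ (m + 3) * ((2 : ℝ) ^ m * (2 : ℝ) ^ (z - m - 1)) = (2 : ℝ) ^ (z - m - 1) / 8 := by
    obtain ⟨X, hX⟩ : ∃ X : ℝ, X = (2 : ℝ)⁻¹ ^ (m + 3) := ⟨_, rfl⟩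
    have h1 : X * (2 : ℝ) ^ (m + 3) = 1 := by
      rw [hX, ← mul_pow]; norm_num
    have h28 : (2 : ℝ) ^ (m + 3) = (2 : ℝ) ^ m * 8 := by rw [pow_add]; norm_num
    rw [h28] at h1
    rw [← hX]
    calc X * ((2 : ℝ) ^ m * (2 : ℝ) ^ (z - m - 1)) = X * ((2 : ℝ) ^ m * 8) * (2 : ℝ) ^ (z - m - 1) / 8 := by ring
      _ = (2 : ℝ) ^ (z - m - 1) / 8 := by rw [h1, one_mul]
  rw [show (((coset z ε).filter fun u => testParity β r u % 2 = affTarget μ₀ S u % 2).card : ℝ) =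
      (((coset z ε).filter agree).card : ℝ) from rfl]
  rw [hpow, sub_mul, one_mul, hinv]
  linarith

/-- **Theorem 37.F′ for a SUB-ROW base row — PROVED** (`Exp38p2.FibreNonExact38` with (NH) in place of (NH_{s₀})): `m` odd, `|Y| ≥ 1`,
`β_{k₀}|_M` `a`-compatible with at least two support coins, (NH) ⇒ every `𝔽₂`-affine target is missed on a `2^{−(m+3)}` fraction of `H_ε`. -/
theorem fibreNonExact37NH_subrow (z s m : ℕ) (ι : Fin m ↪ Fin z) (β : Fin s → Fin z → ZMod 3)
    (r : Fin s → ZMod 3) (k₀ : Fin s) (a : Fin m → Bool) (hm : Odd m) (hz : 1 ≤ z - m)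
    (hc : Compatible a (restrictM ι β k₀)) (h2 : 2 ≤ (univ.filter fun i : Fin m => β k₀ (ι i) ≠ 0).card)
    (hNH : NHCond ι a β) (ε μ₀ : ℕ) (S : Finset (Fin z)) :
    (((coset z ε).filter fun u => testParity β r u % 2 = affTarget μ₀ S u % 2).card : ℝ)
      ≤ (1 - (2 : ℝ)⁻¹ ^ (m + 3)) * (2 : ℝ) ^ (z - 1) :=
  fibreNonExact37NH_of_genuine z s m ι β r k₀ a hm hz hNH ε μ₀ S (accSet_subrow_genuine ι β r a ε hm k₀ hc h2)

end Summit.QuantumAdvantage.AdviceFreeQNC0.Exp37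

end
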